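/-
Copyright (c) 2026 the pub-hodgecm-mathlib formalisation cell (harness21).  Prover seat hodgecm-mathlib-F0P2-p01 (g15), 2026-09-01.  «S3-ram» seeding wave (LEAD F0P3a-plan (g12)
T11-41; owner∕desk F0P3a-p06 (g15); END F0P3a-p03 (g16) word 21:58:42Z): row «(U)-ram TWO-LAYER HEAD», FILE C — the HEAD (and the empty rank-one boundary row).
-/
import Literature.NumberTheory.Rogawski1990.LevelOnePieceBoundaryValueRamified              -- ★ p846963 (this seat) FILE B: row (R1) `exists_boundaryValue_of_levelOne_ramified`; brings the inert V-BD adapters, RIGID-2-ram, the frame ★ p846897, `σ_w ≡ id`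
import Literature.NumberTheory.Rogawski1990.LevelOnePieceDepthOneStrataValuesRamified        -- ★ p846992 (F0P3a-p05 (g16)) the DEPTH-1 ORGAN: rows (R2)(R3)(R4)(R5) `exists_depthOneStrataValues_of_levelOne_ramified`, `redMat_placeForm_mul_depthOne_eq_transpose_mul_of_ramified`
import Literature.NumberTheory.Automorphic.UnitaryThreeBoundaryRigidityLevelTwoRamified        -- ★ p846855 (B-p14 (g37)) NO-TV `isIntMatrix_smul_sub_one_of_sq_of_residual_trivial`
import Literature.GroupTheory.SpecificGroups.OrthogonalThreeSymmetricNilpotentOrbits          -- ★ p846945 (F0P3-p03 (g14)): `exists_eq_sq_or_eq_sq_mul_of_not_isSquare`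
import HarnessLib

/-!
# A `v`-level-1 `K`-class piece at a TAME-RAMIFIED non-split place is constant on the FIVE two-layer strata of `K ⧸ K(ϖ_v)` (Rogawski 1990 §3.9 ∕ §4.9; Tits 1979 §3.5)

Topic `NumberTheory/Rogawski1990`; namespace `Literature.NumberTheory.Rogawski1990`.  THEOREMS ONLY (no definition, no instance, no notation, no named fact, no `sorry`).
Cell `pub/hodgecm-mathlib` (D-0151), crux H413 = `stmt-HodgeConjecture-24833`; road «S3-ram» (Literature seeding, LEAD F0P3a-plan (g12) T11-41∕T11-50 (2); owner F0P3a-p06 (g15)),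
row «(U)-ram TWO-LAYER HEAD» (END F0P3a-p03 (g16) 21:46:46Z∕21:58:42Z; ref5 (g4) R-234∕R-236: «the piece-strata currency of record at :118»), FILE C of three.

SETTING as in FILE B (★ `LevelOnePieceBoundaryValueRamified`): `v` tame-ramified non-split, `K = U(H′)(𝒪_v)` with an integral antidiagonal frame `H′_w = (−det H′_w) • ᵗ(σ_w A) J₀ A`,
`g` an `Ad K`-invariant function on `G′_v = U(H′)(L⁺_v)` LEFT-invariant under `K(ϖ_v) = K_w(2)` (the fold's :118 token `(toPlace v w ϖ_v) ^ 1`), `ϖ` a uniformiser of `L_w`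
with `σ_w ϖ = −ϖ` (the fold's block).  `K ⧸ K(ϖ_v) ≅ O₃(𝔽_q) ⋉ 𝔭̄` has two residual layers: LAYER 1 the class of `red(k_w)` in `O(J̄)(𝔽_q)` — `1` or regular unipotent only
(no transvections, §1); LAYER 2, on `red(k_w) = 1`, the `O(J̄)`-orbit of the depth-1 residue `N(k) = red(ϖ⁻¹(k_w − 1))`, a NILPOTENT `J̄`-SELFADJOINT matrix (`𝔭̄`-layer), classified
by (rank, residue square class of the quadratic form `z ↦ z ⬝ᵥ (J̄ N(k)) *ᵥ z` for rank 1): `{0 ∣ N(λ), N(ελ) ∣ regular}` (★ p846873∕p846931∕p846945∕p846957, F0P3-p03 (g14)).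

* §1 `rank_redMat_sub_one_ne_one_of_ramified` — row (R1′): NO rank-1 boundary stratum (CM dress of NO-TV ★ p846855 through the frame ★ p846897).
* §2 `apply_eq_apply_one_or_apply_eq_apply_nonsquare_of_sq_mul` — a function on a finite field constant on square classes takes the values `c₁ 1` (squares) and `c₁ ε` (non-squares) off `0`.
* §3 **`exists_twoLayerStrataValues_of_levelOne_ramified`** — THE HEAD: `∃ (c c' : ℕ → ℂ) (c₁ : 𝓀_w → ℂ)` with rows (R1) boundary-regular in a `v`-deep class ↦ `c 2` (FILE B, RIGID-2-ram ★ p846886),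
  (R2)∕(R3) interior of depth-1 rank `0`∕`2` ↦ `c' 0`∕`c' 2`, (R4) interior of depth-1 rank `1` with form value `t ≠ 0` ↦ `c₁ t`, (R5) `c₁ (a²t) = c₁ t` (the DEPTH-1 ORGAN ★
  `exists_depthOneStrataValues_of_levelOne_ramified`, F0P3a-p05 (g16), over ★ p846899 and the finite half) — binders = the piece group of the fold's `stub_levelOneRowsRam` :118
  VERBATIM; the three clause hands (e1)(e2)(e3) of the «S3-ram» rows socket take (R1)–(R4) as their strata-value hypotheses (F0P3-p02 (g16) L4∕L5, F0P3-p01 (g18), A-p16 (g31), A-p12 (g23)).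
* §4 `exists_twoLayerStrataValues_of_levelOne_ramified_of_not_isSquare` — the same with the rank-1 row read against a chosen non-square `ε`: FIVE values `{c 2 | c' 0, c' 2 | c₁ 1, c₁ ε}`.

HONEST LABEL: HC_CM is proved only modulo the 2 remaining named inputs (hLiu418 24832, h413 24833) until rung 0 closes; «S3-ram» is Literature seeding with no books consequence;
this file is unconditional local algebra and discharges nothing by itself.

## References
* [Rogawski1990] J. D. Rogawski, *Automorphic Representations of Unitary Groups in Three Variables*, Ann. of Math. Stud. 123 (1990): §3.9 p. 32, Prop. 3.9.1; §4.9 p. 54.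
* [Tits1979] J. Tits, *Reductive groups over local fields*, PSPM 33.1 (1979): §3.3.3, §3.5.
* [Wilson2009] R. A. Wilson, *The Finite Simple Groups*, GTM 251 (2009): §3.7.1–§3.7.2 (`O₃(q)`).
-/

set_option autoImplicit false

noncomputable section

open NumberField IsDedekindDomain Matrix ValuativeRel
open Literature.NumberTheory.Automorphic Literature.NumberTheory.GaloisRepresentations Literature.NumberTheory.Automorphic.UnitaryGroup
open Literature.NumberTheory.Automorphic.IntegralReduction Literature.GroupTheory.SpecificGroups
open Literature.NumberTheory.Automorphic.HermitianLattice Literature.NumberTheory.Automorphic.UnitaryLatticeTree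
open scoped Matrix MatrixGroups ValuativeRel WithZero

namespace Literature.NumberTheory.Rogawski1990

open Literature.NumberTheory.Automorphic.Liu2021.LemD1IndexedNonVacuityRamifiedConverse (valued_galAdicCompletionMap_sub_lt_one_of_ramified)

/-! ## §1 Row (R1′): no rank-one boundary stratum at a tame-ramified place -/

set_option maxHeartbeats 800000 in
-- budget only: one statement-heavy declaration (the CM-place tokens); no search tactic runs long here.
/-- **NO RANK-ONE BOUNDARY STRATUM AT A TAME-RAMIFIED PLACE** (row (R1′) of the two-layer head): for `x ∈ K = U(H′)(𝒪_v)` with `red(x_w) − 1` nilpotent,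
`rank(red x_w − 1) ≠ 1` — through the frame `e x = A x_w A⁻¹ ∈ U(σ_w, J₀)(L_w) ∩ GL₃(𝒪_w)` (★ p846897) a rank-`1` residue would give `(e x − 1)² ≡ 0 (mod ϖ)` with
`e x ≢ 1 (mod ϖ)`, against NO-TV ★ p846855 `isIntMatrix_smul_sub_one_of_sq_of_residual_trivial` (`σ_w ≡ id (mod 𝔪_w)`, `|2| = 1`: no transvections in `O₃(𝔽_q)`).  So layer 1 of
`K ⧸ K(ϖ_v)` has the two strata `{1̄}` (the interior) and `{regular}` only. [cite: Rogawski1990, §3.9 p. 32] [cite: Tits1979, §3.5] [cite: Wilson2009, §3.7.2] -/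
theorem rank_redMat_sub_one_ne_one_of_ramified
    (L : Type) [Field L] [NumberField L] [IsCMField L] (H' : Matrix (Fin 3) (Fin 3) L)
    {v : HeightOneSpectrum (𝓞 ↥(maximalRealSubfield L))}
    (w : PlacesOver L v) (hw : IsCMField.complexConj L • w.1 = w.1) (he : v.asIdeal.ramificationIdx' w.1.asIdeal ≠ 1)
    (hH'w : IsUnit (placeForm H' w.1)) (h2 : IsUnit (2 : 𝒪[(w.1.adicCompletion L)]))
    (ϖ : (w.1.adicCompletion L)) (hϖ : Valued.v ϖ = WithZero.exp (-1 : ℤ))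
    (A : GL (Fin 3) (w.1.adicCompletion L)) (hA : A ∈ glInt 3 (w.1.adicCompletion L))
    (hframe : placeForm H' w.1 = (-(placeForm H' w.1).det) • formCongr (galAdicCompletionMap (L := L) (IsCMField.complexConj L) hw) A ((StdForm.antidiagonal 3).over (w.1.adicCompletion L)))
    {x : ((cmDatum L 3 H').Local v)} (hxK : x ∈ cmLocalIntegralLevel L 3 H' v)
    (hnil : (redMat (((x).val : GL (Fin 3) (UnitaryGroup.LocalRing L v)).val.map (Pi.evalRingHom (fun w' : PlacesOver L v => w'.1.adicCompletion L) w)) - 1) ^ 3 = 0) :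
    (redMat (((x).val : GL (Fin 3) (UnitaryGroup.LocalRing L v)).val.map (Pi.evalRingHom (fun w' : PlacesOver L v => w'.1.adicCompletion L) w)) - 1).rank ≠ 1 := by
  classical
  intro hr1
  have hc1 : IsCMField.complexConj L ≠ 1 := IsCMField.complexConj_ne_one L
  haveI : Algebra.IsQuadraticExtension ↥(maximalRealSubfield L) L := IsCMField.isQuadraticExtension L
  have hres : ∀ z : (w.1.adicCompletion L), Valued.v z ≤ 1 → Valued.v ((galAdicCompletionMap (L := L) (IsCMField.complexConj L) hw) z - z) < 1 :=
    fun z hz => valued_galAdicCompletionMap_sub_lt_one_of_ramified L (IsCMField.complexConj L) v hc1 w hw he z hz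
  have h2v : Valued.v (2 : (w.1.adicCompletion L)) = 1 := (isUnit_two_integer_iff_valued_eq_one L w.1).1 h2
  have hϖu : IsUniformizingElement ϖ := isUniformizingElement_of_v_eq hϖ
  have hϖ0 : ϖ ≠ 0 := fun h => by rw [h, map_zero] at hϖ; exact WithZero.coe_ne_zero hϖ.symm
  have hϖ1 : Valued.v ϖ < 1 := by rw [hϖ, ← WithZero.exp_zero]; exact WithZero.exp_lt_exp.2 (by norm_num)
  -- the frame
  obtain ⟨e, hfr, hKe, -⟩ := exists_frame_of_eq_smul_formCongr_antidiagonal L H' w hw hH'w A hA hframe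
  have hJw : placeForm (Matrix.of fun i j : Fin 3 => if i.val + j.val + 1 = 3 then (1 : L) else 0) w.1 = ((StdForm.antidiagonal 3).over (w.1.adicCompletion L)) := by
    rw [placeForm, antidiagOne_eq_over, StdForm.over_map]
  have hU : ∀ z, ((e z).val : GL (Fin 3) (w.1.adicCompletion L)) ∈ (unitaryGroupOfForm (galAdicCompletionMap (L := L) (IsCMField.complexConj L) hw) ((StdForm.antidiagonal 3).over (w.1.adicCompletion L))) := fun z => by
    rw [← hJw]; exact (e z).2
  have hAi : IsIntMatrix (A : Matrix (Fin 3) (Fin 3) (w.1.adicCompletion L)) := ((mem_glInt_iff_isIntMatrix L 3 w A).1 hA).1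
  have hAi' : IsIntMatrix ((A⁻¹ : GL (Fin 3) (w.1.adicCompletion L)) : Matrix (Fin 3) (Fin 3) (w.1.adicCompletion L)) := ((mem_glInt_iff_isIntMatrix L 3 w A).1 hA).2
  have hAA' : (A : Matrix (Fin 3) (Fin 3) (w.1.adicCompletion L)) * ((A⁻¹ : GL (Fin 3) (w.1.adicCompletion L)) : Matrix (Fin 3) (Fin 3) (w.1.adicCompletion L)) = 1 := by rw [← Units.val_mul, mul_inv_cancel, Units.val_one]
  have hA'A : ((A⁻¹ : GL (Fin 3) (w.1.adicCompletion L)) : Matrix (Fin 3) (Fin 3) (w.1.adicCompletion L)) * (A : Matrix (Fin 3) (Fin 3) (w.1.adicCompletion L)) = 1 := by rw [← Units.val_mul, inv_mul_cancel, Units.val_one]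
  -- the two matrices of `x`
  obtain ⟨X₀, hX₀⟩ : ∃ X : GL (Fin 3) (w.1.adicCompletion L), X = (((localNonsplitEquiv (IsCMField.complexConj L) H' (IsCMField.complexConj_ne_one L) w hw x)).val : GL (Fin 3) (w.1.adicCompletion L)) := ⟨_, rfl⟩
  obtain ⟨XR, hXR⟩ : ∃ X : GL (Fin 3) (w.1.adicCompletion L), X = ((e x).val : GL (Fin 3) (w.1.adicCompletion L)) := ⟨_, rfl⟩
  have hXRT : XR = A * X₀ * A⁻¹ := by rw [hXR, hX₀]; exact hfr x
  have hxU : XR ∈ (unitaryGroupOfForm (galAdicCompletionMap (L := L) (IsCMField.complexConj L) hw) ((StdForm.antidiagonal 3).over (w.1.adicCompletion L))) := by rw [hXR]; exact hU _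
  have hxint : IsIntMatrix (XR : Matrix (Fin 3) (Fin 3) (w.1.adicCompletion L)) := by
    rw [hXR]; exact ((mem_glInt_iff_isIntMatrix L 3 w _).1 ((hKe x).1 hxK)).1
  have hX₀int : X₀ ∈ glInt 3 (w.1.adicCompletion L) := by
    rw [hX₀]; exact (mem_localIntegralLevel_iff_of_smul_eq (IsCMField.complexConj L) 3 H' hc1 w hw x).1 hxK
  have hMx : ((X₀ : GL (Fin 3) (w.1.adicCompletion L)) : Matrix (Fin 3) (Fin 3) (w.1.adicCompletion L)) = (((x).val : GL (Fin 3) (UnitaryGroup.LocalRing L v)).val.map (Pi.evalRingHom (fun w' : PlacesOver L v => w'.1.adicCompletion L) w)) := by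
    rw [hX₀]; exact coe_localNonsplitEquiv_apply L H' v w hw x
  -- the residual nilpotent and the dictionary «rank ↔ congruences» (as in ★ `apply_eq_of_two_deep_of_rank_redMat_sub_one`)
  obtain ⟨Nx, hNx⟩ : ∃ N : Matrix (Fin 3) (Fin 3) 𝓀[(w.1.adicCompletion L)], N = redMat ((X₀ : GL (Fin 3) (w.1.adicCompletion L)) : Matrix (Fin 3) (Fin 3) (w.1.adicCompletion L)) - 1 := ⟨_, rfl⟩
  have hnilN : IsNilpotent Nx := ⟨3, by rw [hNx, hMx]; exact hnil⟩
  have hr1' : Nx.rank = 1 := by rw [hNx, hMx]; exact hr1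
  obtain ⟨hNne, hsq⟩ := (rank_eq_one_iff_of_isNilpotent hnilN).1.1 hr1'
  have hX₀v : ValBound 1 ((X₀ : GL (Fin 3) (w.1.adicCompletion L)) : Matrix (Fin 3) (Fin 3) (w.1.adicCompletion L)) := valBound_one_of_mem_glInt hX₀int
  have hsubv : ValBound 1 (((X₀ : GL (Fin 3) (w.1.adicCompletion L)) : Matrix (Fin 3) (Fin 3) (w.1.adicCompletion L)) - 1) := hX₀v.sub valBound_one
  have hredsub : redMat (((X₀ : GL (Fin 3) (w.1.adicCompletion L)) : Matrix (Fin 3) (Fin 3) (w.1.adicCompletion L)) - 1) = Nx := by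
    rw [hNx, redMat_sub hX₀v valBound_one, redMat_one]
  have hsqv : ValBound 1 ((((X₀ : GL (Fin 3) (w.1.adicCompletion L)) : Matrix (Fin 3) (Fin 3) (w.1.adicCompletion L)) - 1) ^ 2) := by
    have h := hsubv.mul hsubv
    rw [one_mul, ← sq] at h
    exact h
  have hredsq : redMat ((((X₀ : GL (Fin 3) (w.1.adicCompletion L)) : Matrix (Fin 3) (Fin 3) (w.1.adicCompletion L)) - 1) ^ 2) = Nx * Nx := by
    rw [sq, redMat_mul hsubv hsubv, hredsub]
  -- `N² = 0` gives `(x_w − 1)² ≡ 0 (ϖ)`, transported to `e x`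
  have hx2₀ : IsIntMatrix (ϖ⁻¹ • (((X₀ : GL (Fin 3) (w.1.adicCompletion L)) : Matrix (Fin 3) (Fin 3) (w.1.adicCompletion L)) - 1) ^ 2) := by
    have hred0 : redMat ((((X₀ : GL (Fin 3) (w.1.adicCompletion L)) : Matrix (Fin 3) (Fin 3) (w.1.adicCompletion L)) - 1) ^ 2) = 0 := by rw [hredsq, hsq]
    have hlt := (redMat_eq_zero_iff_forall_valuation_lt_one hsqv).1 hred0
    refine (UnitaryGroup.isIntMatrix_inv_smul_iff hϖ0 _).2 fun i j => ?_
    rw [hϖ]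
    exact (v_lt_one_iff _).1 ((v_lt_one_iff_valuation_lt_one _).2 (hlt i j))
  have hXm : (XR : Matrix (Fin 3) (Fin 3) (w.1.adicCompletion L)) = (A : Matrix (Fin 3) (Fin 3) (w.1.adicCompletion L)) * ((X₀ : GL (Fin 3) (w.1.adicCompletion L)) : Matrix (Fin 3) (Fin 3) (w.1.adicCompletion L)) * ((A⁻¹ : GL (Fin 3) (w.1.adicCompletion L)) : Matrix (Fin 3) (Fin 3) (w.1.adicCompletion L)) := by
    rw [hXRT]; simp only [Units.val_mul]
  have hx2 : IsIntMatrix (ϖ⁻¹ • ((XR : Matrix (Fin 3) (Fin 3) (w.1.adicCompletion L)) - 1) ^ 2) := by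
    rw [hXm]; exact isIntMatrix_smul_conj_sub_one_sq ϖ⁻¹ hAi hAi' hAA' hA'A hx2₀
  -- NO-TV: `e x ≡ 1 (ϖ)`, hence `x_w ≡ 1 (ϖ)`, hence `N = 0`
  have hx1 := isIntMatrix_smul_sub_one_of_sq_of_residual_trivial hϖ hres h2v hxU hxint hx2
  have hX₀m : ((X₀ : GL (Fin 3) (w.1.adicCompletion L)) : Matrix (Fin 3) (Fin 3) (w.1.adicCompletion L)) = ((A⁻¹ : GL (Fin 3) (w.1.adicCompletion L)) : Matrix (Fin 3) (Fin 3) (w.1.adicCompletion L)) * (XR : Matrix (Fin 3) (Fin 3) (w.1.adicCompletion L)) * (A : Matrix (Fin 3) (Fin 3) (w.1.adicCompletion L)) := by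
    have h : X₀ = A⁻¹ * XR * A := by rw [hXRT]; group
    rw [h]; simp only [Units.val_mul]
  have hx1₀ : IsIntMatrix (ϖ⁻¹ • (((X₀ : GL (Fin 3) (w.1.adicCompletion L)) : Matrix (Fin 3) (Fin 3) (w.1.adicCompletion L)) - 1)) := by
    rw [hX₀m]; exact isIntMatrix_smul_conj_sub_one ϖ⁻¹ hAi' hAi hA'A hx1
  have hle : ∀ i j, valuation (w.1.adicCompletion L) ((((X₀ : GL (Fin 3) (w.1.adicCompletion L)) : Matrix (Fin 3) (Fin 3) (w.1.adicCompletion L)) - 1) i j) ≤ valuation (w.1.adicCompletion L) ϖ := fun i j =>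
    (v_le_iff_valuation_le _ _).1 ((UnitaryGroup.isIntMatrix_inv_smul_iff hϖ0 _).1 hx1₀ i j)
  have h0 : (redMat ((X₀ : GL (Fin 3) (w.1.adicCompletion L)) : Matrix (Fin 3) (Fin 3) (w.1.adicCompletion L)) - 1).rank = 0 := (rank_redMat_sub_one_eq_zero_iff_forall_valuation_le hϖu hX₀int).2 hle
  rw [← hNx] at h0
  exact hNne ((Literature.GroupTheory.SpecificGroups.rank_eq_zero_iff_eq_zero Nx).1 h0)

/-! ## §2 A function on a finite field constant on square classes -/

/-- **The rank-1 index read against a non-square `ε`**: if `c₁ : 𝓀 → α` is constant on square classes (`c₁ (a²t) = c₁ t`, the head's rider (R5)) over a finite field `𝓀`,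
then at every `t ≠ 0`, `c₁ t = c₁ 1` if `t` is a square and `c₁ t = c₁ ε` otherwise (`𝓀ˣ ⧸ 𝓀ˣ² = {1, ε}`, ★ `exists_eq_sq_or_eq_sq_mul_of_not_isSquare`) — the two rank-1
interior values `{c₁ 1, c₁ ε}` of A-p16's five-strata currency `{bd | 0, reg | 1⁺, 1⁻}`. [cite: Rogawski1990, §4.9 p. 54] [cite: Serre1973, Ch. I §3.1] -/
theorem apply_eq_apply_one_or_apply_eq_apply_nonsquare_of_sq_mul {𝓀 : Type*} [Field 𝓀] [Fintype 𝓀] {α : Type*} {ε : 𝓀} (hε : ¬ IsSquare ε)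
    (c₁ : 𝓀 → α) (hsq : ∀ t a : 𝓀, a ≠ 0 → c₁ (a ^ 2 * t) = c₁ t) {t : 𝓀} (ht : t ≠ 0) :
    (IsSquare t → c₁ t = c₁ 1) ∧ (¬ IsSquare t → c₁ t = c₁ ε) := by
  constructor
  · rintro ⟨a, rfl⟩
    have ha : a ≠ 0 := fun h => ht (by rw [h, mul_zero])
    rw [← hsq 1 a ha, sq, mul_one]
  · intro hns
    rcases exists_eq_sq_or_eq_sq_mul_of_not_isSquare hε ht with ⟨a, ha⟩ | ⟨a, ha⟩
    · exact absurd ⟨a, by rw [ha, sq, mul_one]⟩ hns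
    · have ha0 : a ≠ 0 := fun h => ht (by rw [ha, h, sq, zero_mul, zero_mul])
      rw [ha, hsq ε a ha0]

/-! ## §3 THE TWO-LAYER HEAD -/

set_option maxHeartbeats 800000 in
-- budget only: one statement-heavy declaration (the fold's :118 tokens); no search tactic runs long here.
/-- **THE TWO-LAYER (U)-ram HEAD — a `v`-level-1 `K`-class piece at a tame-ramified place is constant on the five two-layer strata.**  Binders = the piece group of the fold's
`stub_levelOneRowsRam` :118 VERBATIM (`hH' w hw he hH'w hH'i h2`, block `ϖ hϖ hσϖ`, frame `A hA hframe`, piece `g hginv hg1`).  Tokens: `x_w := (x.val : GL₃(∏ L_w′)).val.map (eval w)`,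
`N(x) := redMat (ϖ⁻¹ • (x_w − 1))`, `J̄ := redMat (placeForm H′ w.1)`, `e := localNonsplitEquiv`.  ROWS: (R1) `red(x_w) − 1` nilpotent of rank 2 and `x` in a `v`-deep class
(`∃ y, (e(yxy⁻¹)) ≡ 1 (mod ϖ_v)`) ↦ `c 2` (FILE B ★ p846963 over RIGID-2-ram ★ p846886), `c 0 = 0`; (R2)∕(R3) `x_w ≡ 1 (ϖ)`, `N(x)` nilpotent of rank `0`∕`2` ↦ `c' 0`∕`c' 2`;
(R4) rank `1` with `z ⬝ᵥ (J̄ N(x)) *ᵥ z = t ≠ 0` ↦ `c₁ t`; (R5) `c₁ (a² t) = c₁ t` — (R2)–(R5) = the DEPTH-1 ORGAN ★ `exists_depthOneStrataValues_of_levelOne_ramified` (F0P3a-p05 (g16)).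
[cite: Rogawski1990, §3.9 p. 32, Prop. 3.9.1; §4.9 p. 54] [cite: Tits1979, §3.5] -/
theorem exists_twoLayerStrataValues_of_levelOne_ramified
    (L : Type) [Field L] [NumberField L] [IsCMField L] (H' : Matrix (Fin 3) (Fin 3) L)
    {v : HeightOneSpectrum (𝓞 ↥(maximalRealSubfield L))}
    (hH' : (H'.map (cmConjRingHom L)).transpose = H') (w : PlacesOver L v)
    (hw : IsCMField.complexConj L • w.1 = w.1) (he : v.asIdeal.ramificationIdx' w.1.asIdeal ≠ 1)
    (hH'w : IsUnit (placeForm H' w.1)) (hH'i : hH'w.unit ∈ glInt 3 (w.1.adicCompletion L))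
    (h2 : IsUnit (2 : 𝒪[(w.1.adicCompletion L)]))
    (ϖ : (w.1.adicCompletion L)) (hϖ : Valued.v ϖ = WithZero.exp (-1 : ℤ)) (hσϖ : galAdicCompletionMap (L := L) (IsCMField.complexConj L) hw ϖ = -ϖ)
    (A : GL (Fin 3) (w.1.adicCompletion L)) (hA : A ∈ glInt 3 (w.1.adicCompletion L))
    (hframe : placeForm H' w.1 = (-(placeForm H' w.1).det) • formCongr (galAdicCompletionMap (L := L) (IsCMField.complexConj L) hw) A ((StdForm.antidiagonal 3).over (w.1.adicCompletion L)))
    (g : ((cmDatum L 3 H').Local v) → ℂ)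
    (hginv : ∀ u ∈ cmLocalIntegralLevel L 3 H' v, ∀ x, g (u * x * u⁻¹) = g x)
    (hg1 : ∀ u : ((cmDatum L 3 H').Local v),
      (∀ a b, Valued.v (((toPlace v w (HeckeCharacter.uniformizer ↥(maximalRealSubfield L) v : v.adicCompletion ↥(maximalRealSubfield L))) ^ 1)⁻¹ *
        ((((localNonsplitEquiv (IsCMField.complexConj L) H' (IsCMField.complexConj_ne_one L) w hw u :
            ↥(unitaryGroupOfForm (galAdicCompletionMap (L := L) (IsCMField.complexConj L) hw) (placeForm H' w.1))) : GL (Fin 3) (w.1.adicCompletion L)) :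
              Matrix (Fin 3) (Fin 3) (w.1.adicCompletion L)) a b - (1 : Matrix (Fin 3) (Fin 3) (w.1.adicCompletion L)) a b)) ≤ 1) →
      ∀ x, g (u * x) = g x) :
    ∃ (c c' : ℕ → ℂ) (c₁ : 𝓀[(w.1.adicCompletion L)] → ℂ),
      -- (R1) BOUNDARY (layer 1): residually REGULAR unipotent, in a `v`-deep class ⇒ ONE value `c 2` (RIGID-2-ram ★ p846886); `c 0 = 0` bookkeeping
      c 0 = 0 ∧
      (∀ x : ((cmDatum L 3 H').Local v), (x ∈ cmLocalIntegralLevel L 3 H' v ∧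
        (redMat (((x).val : GL (Fin 3) (UnitaryGroup.LocalRing L v)).val.map (Pi.evalRingHom (fun w' : PlacesOver L v => w'.1.adicCompletion L) w)) - 1) ^ 3 = 0 ∧
        (redMat (((x).val : GL (Fin 3) (UnitaryGroup.LocalRing L v)).val.map (Pi.evalRingHom (fun w' : PlacesOver L v => w'.1.adicCompletion L) w)) - 1).rank = 2 ∧
        ∃ y : ((cmDatum L 3 H').Local v), (∀ a b, Valued.v (((toPlace v w (HeckeCharacter.uniformizer ↥(maximalRealSubfield L) v : v.adicCompletion ↥(maximalRealSubfield L))) ^ 1)⁻¹ *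
          ((((localNonsplitEquiv (IsCMField.complexConj L) H' (IsCMField.complexConj_ne_one L) w hw (y * x * y⁻¹) :
            ↥(unitaryGroupOfForm (galAdicCompletionMap (L := L) (IsCMField.complexConj L) hw) (placeForm H' w.1))) : GL (Fin 3) (w.1.adicCompletion L)) :
              Matrix (Fin 3) (Fin 3) (w.1.adicCompletion L)) a b - (1 : Matrix (Fin 3) (Fin 3) (w.1.adicCompletion L)) a b)) ≤ 1)) →
        g x = c 2) ∧
      -- (R2) INTERIOR, depth-1 rank 0 (`x_w ≡ 1 (ϖ_w²)`)
      (∀ x : ((cmDatum L 3 H').Local v), (x ∈ cmLocalIntegralLevel L 3 H' v ∧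
        (∀ a b, Valued.v (ϖ⁻¹ * ((((x).val : GL (Fin 3) (UnitaryGroup.LocalRing L v)).val.map (Pi.evalRingHom (fun w' : PlacesOver L v => w'.1.adicCompletion L) w)) a b - (1 : Matrix (Fin 3) (Fin 3) (w.1.adicCompletion L)) a b)) ≤ 1) ∧
        (redMat (ϖ⁻¹ • ((((x).val : GL (Fin 3) (UnitaryGroup.LocalRing L v)).val.map (Pi.evalRingHom (fun w' : PlacesOver L v => w'.1.adicCompletion L) w)) - 1))) ^ 3 = 0 ∧ (redMat (ϖ⁻¹ • ((((x).val : GL (Fin 3) (UnitaryGroup.LocalRing L v)).val.map (Pi.evalRingHom (fun w' : PlacesOver L v => w'.1.adicCompletion L) w)) - 1))).rank = 0) →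
        g x = c' 0) ∧
      -- (R3) INTERIOR, depth-1 rank 2 (regular nilpotent in `𝔭`)
      (∀ x : ((cmDatum L 3 H').Local v), (x ∈ cmLocalIntegralLevel L 3 H' v ∧
        (∀ a b, Valued.v (ϖ⁻¹ * ((((x).val : GL (Fin 3) (UnitaryGroup.LocalRing L v)).val.map (Pi.evalRingHom (fun w' : PlacesOver L v => w'.1.adicCompletion L) w)) a b - (1 : Matrix (Fin 3) (Fin 3) (w.1.adicCompletion L)) a b)) ≤ 1) ∧
        (redMat (ϖ⁻¹ • ((((x).val : GL (Fin 3) (UnitaryGroup.LocalRing L v)).val.map (Pi.evalRingHom (fun w' : PlacesOver L v => w'.1.adicCompletion L) w)) - 1))) ^ 3 = 0 ∧ (redMat (ϖ⁻¹ • ((((x).val : GL (Fin 3) (UnitaryGroup.LocalRing L v)).val.map (Pi.evalRingHom (fun w' : PlacesOver L v => w'.1.adicCompletion L) w)) - 1))).rank = 2) →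
        g x = c' 2) ∧
      -- (R4) INTERIOR, depth-1 rank 1, indexed by the (non-zero) VALUE of the residual quadratic form `z ↦ z ⬝ᵥ (J̄ N) *ᵥ z`
      (∀ (x : ((cmDatum L 3 H').Local v)) (z : Fin 3 → 𝓀[(w.1.adicCompletion L)]), (x ∈ cmLocalIntegralLevel L 3 H' v ∧
        (∀ a b, Valued.v (ϖ⁻¹ * ((((x).val : GL (Fin 3) (UnitaryGroup.LocalRing L v)).val.map (Pi.evalRingHom (fun w' : PlacesOver L v => w'.1.adicCompletion L) w)) a b - (1 : Matrix (Fin 3) (Fin 3) (w.1.adicCompletion L)) a b)) ≤ 1) ∧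
        (redMat (ϖ⁻¹ • ((((x).val : GL (Fin 3) (UnitaryGroup.LocalRing L v)).val.map (Pi.evalRingHom (fun w' : PlacesOver L v => w'.1.adicCompletion L) w)) - 1))) ^ 3 = 0 ∧ (redMat (ϖ⁻¹ • ((((x).val : GL (Fin 3) (UnitaryGroup.LocalRing L v)).val.map (Pi.evalRingHom (fun w' : PlacesOver L v => w'.1.adicCompletion L) w)) - 1))).rank = 1 ∧
        z ⬝ᵥ ((redMat (placeForm H' w.1) * redMat (ϖ⁻¹ • ((((x).val : GL (Fin 3) (UnitaryGroup.LocalRing L v)).val.map (Pi.evalRingHom (fun w' : PlacesOver L v => w'.1.adicCompletion L) w)) - 1))) *ᵥ z) ≠ 0) →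
        g x = c₁ (z ⬝ᵥ ((redMat (placeForm H' w.1) * redMat (ϖ⁻¹ • ((((x).val : GL (Fin 3) (UnitaryGroup.LocalRing L v)).val.map (Pi.evalRingHom (fun w' : PlacesOver L v => w'.1.adicCompletion L) w)) - 1))) *ᵥ z))) ∧
      -- (R5) the rank-1 index is a residue SQUARE CLASS
      (∀ t a : 𝓀[(w.1.adicCompletion L)], a ≠ 0 → c₁ (a ^ 2 * t) = c₁ t) := by
  obtain ⟨c, hc0, hR1⟩ := exists_boundaryValue_of_levelOne_ramified L H' hH' w hw he hH'w hH'i h2 ϖ hϖ hσϖ A hA hframe g hginv hg1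
  obtain ⟨c', c₁, hR2, hR3, hR4, hR5⟩ := exists_depthOneStrataValues_of_levelOne_ramified L H' hH' w hw he hH'w hH'i h2 ϖ hϖ hσϖ A hA hframe g hginv hg1
  exact ⟨c, c', c₁, hc0, hR1, hR2, hR3, hR4, hR5⟩

/-! ## §4 The head read against a non-square `ε`: the five values `{c 2 | c' 0, c' 2 | c₁ 1, c₁ ε}` -/

set_option maxHeartbeats 800000 in
-- budget only: one statement-heavy declaration (the fold's :118 tokens); no search tactic runs long here.
/-- **THE TWO-LAYER HEAD WITH THE RANK-ONE ROW SPLIT BY A NON-SQUARE `ε`** (A-p16 (g31)'s five-strata currency `{bd | 0, reg | 1⁺, 1⁻}`): as §3, with (R4) replaced by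
(R4□) «form value a non-zero SQUARE ↦ `c₁ 1`» and (R4ε) «form value a NON-SQUARE ↦ `c₁ ε`» (§2 over (R5); `𝓀_w` finite of odd characteristic). [cite: Rogawski1990, §4.9 p. 54] [cite: Tits1979, §3.5] -/
theorem exists_twoLayerStrataValues_of_levelOne_ramified_of_not_isSquare
    (L : Type) [Field L] [NumberField L] [IsCMField L] (H' : Matrix (Fin 3) (Fin 3) L)
    {v : HeightOneSpectrum (𝓞 ↥(maximalRealSubfield L))}
    (hH' : (H'.map (cmConjRingHom L)).transpose = H') (w : PlacesOver L v)
    (hw : IsCMField.complexConj L • w.1 = w.1) (he : v.asIdeal.ramificationIdx' w.1.asIdeal ≠ 1)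
    (hH'w : IsUnit (placeForm H' w.1)) (hH'i : hH'w.unit ∈ glInt 3 (w.1.adicCompletion L))
    (h2 : IsUnit (2 : 𝒪[(w.1.adicCompletion L)]))
    (ϖ : (w.1.adicCompletion L)) (hϖ : Valued.v ϖ = WithZero.exp (-1 : ℤ)) (hσϖ : galAdicCompletionMap (L := L) (IsCMField.complexConj L) hw ϖ = -ϖ)
    (A : GL (Fin 3) (w.1.adicCompletion L)) (hA : A ∈ glInt 3 (w.1.adicCompletion L))
    (hframe : placeForm H' w.1 = (-(placeForm H' w.1).det) • formCongr (galAdicCompletionMap (L := L) (IsCMField.complexConj L) hw) A ((StdForm.antidiagonal 3).over (w.1.adicCompletion L)))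
    (g : ((cmDatum L 3 H').Local v) → ℂ)
    (hginv : ∀ u ∈ cmLocalIntegralLevel L 3 H' v, ∀ x, g (u * x * u⁻¹) = g x)
    (hg1 : ∀ u : ((cmDatum L 3 H').Local v),
      (∀ a b, Valued.v (((toPlace v w (HeckeCharacter.uniformizer ↥(maximalRealSubfield L) v : v.adicCompletion ↥(maximalRealSubfield L))) ^ 1)⁻¹ *
        ((((localNonsplitEquiv (IsCMField.complexConj L) H' (IsCMField.complexConj_ne_one L) w hw u :
            ↥(unitaryGroupOfForm (galAdicCompletionMap (L := L) (IsCMField.complexConj L) hw) (placeForm H' w.1))) : GL (Fin 3) (w.1.adicCompletion L)) :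
              Matrix (Fin 3) (Fin 3) (w.1.adicCompletion L)) a b - (1 : Matrix (Fin 3) (Fin 3) (w.1.adicCompletion L)) a b)) ≤ 1) →
      ∀ x, g (u * x) = g x)
    {ε : 𝓀[(w.1.adicCompletion L)]} (hε : ¬ IsSquare ε) :
    ∃ (c c' : ℕ → ℂ) (c₁ : 𝓀[(w.1.adicCompletion L)] → ℂ),
      -- (R1) BOUNDARY (layer 1): residually REGULAR unipotent, in a `v`-deep class ⇒ ONE value `c 2` (RIGID-2-ram ★ p846886); `c 0 = 0` bookkeeping
      c 0 = 0 ∧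
      (∀ x : ((cmDatum L 3 H').Local v), (x ∈ cmLocalIntegralLevel L 3 H' v ∧
        (redMat (((x).val : GL (Fin 3) (UnitaryGroup.LocalRing L v)).val.map (Pi.evalRingHom (fun w' : PlacesOver L v => w'.1.adicCompletion L) w)) - 1) ^ 3 = 0 ∧
        (redMat (((x).val : GL (Fin 3) (UnitaryGroup.LocalRing L v)).val.map (Pi.evalRingHom (fun w' : PlacesOver L v => w'.1.adicCompletion L) w)) - 1).rank = 2 ∧
        ∃ y : ((cmDatum L 3 H').Local v), (∀ a b, Valued.v (((toPlace v w (HeckeCharacter.uniformizer ↥(maximalRealSubfield L) v : v.adicCompletion ↥(maximalRealSubfield L))) ^ 1)⁻¹ *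
          ((((localNonsplitEquiv (IsCMField.complexConj L) H' (IsCMField.complexConj_ne_one L) w hw (y * x * y⁻¹) :
            ↥(unitaryGroupOfForm (galAdicCompletionMap (L := L) (IsCMField.complexConj L) hw) (placeForm H' w.1))) : GL (Fin 3) (w.1.adicCompletion L)) :
              Matrix (Fin 3) (Fin 3) (w.1.adicCompletion L)) a b - (1 : Matrix (Fin 3) (Fin 3) (w.1.adicCompletion L)) a b)) ≤ 1)) →
        g x = c 2) ∧
      -- (R2) INTERIOR, depth-1 rank 0 (`x_w ≡ 1 (ϖ_w²)`)
      (∀ x : ((cmDatum L 3 H').Local v), (x ∈ cmLocalIntegralLevel L 3 H' v ∧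
        (∀ a b, Valued.v (ϖ⁻¹ * ((((x).val : GL (Fin 3) (UnitaryGroup.LocalRing L v)).val.map (Pi.evalRingHom (fun w' : PlacesOver L v => w'.1.adicCompletion L) w)) a b - (1 : Matrix (Fin 3) (Fin 3) (w.1.adicCompletion L)) a b)) ≤ 1) ∧
        (redMat (ϖ⁻¹ • ((((x).val : GL (Fin 3) (UnitaryGroup.LocalRing L v)).val.map (Pi.evalRingHom (fun w' : PlacesOver L v => w'.1.adicCompletion L) w)) - 1))) ^ 3 = 0 ∧ (redMat (ϖ⁻¹ • ((((x).val : GL (Fin 3) (UnitaryGroup.LocalRing L v)).val.map (Pi.evalRingHom (fun w' : PlacesOver L v => w'.1.adicCompletion L) w)) - 1))).rank = 0) →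
        g x = c' 0) ∧
      -- (R3) INTERIOR, depth-1 rank 2 (regular nilpotent in `𝔭`)
      (∀ x : ((cmDatum L 3 H').Local v), (x ∈ cmLocalIntegralLevel L 3 H' v ∧
        (∀ a b, Valued.v (ϖ⁻¹ * ((((x).val : GL (Fin 3) (UnitaryGroup.LocalRing L v)).val.map (Pi.evalRingHom (fun w' : PlacesOver L v => w'.1.adicCompletion L) w)) a b - (1 : Matrix (Fin 3) (Fin 3) (w.1.adicCompletion L)) a b)) ≤ 1) ∧
        (redMat (ϖ⁻¹ • ((((x).val : GL (Fin 3) (UnitaryGroup.LocalRing L v)).val.map (Pi.evalRingHom (fun w' : PlacesOver L v => w'.1.adicCompletion L) w)) - 1))) ^ 3 = 0 ∧ (redMat (ϖ⁻¹ • ((((x).val : GL (Fin 3) (UnitaryGroup.LocalRing L v)).val.map (Pi.evalRingHom (fun w' : PlacesOver L v => w'.1.adicCompletion L) w)) - 1))).rank = 2) →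
        g x = c' 2) ∧
      -- (R4□)∕(R4ε) INTERIOR, depth-1 rank 1: value `c₁ 1` when the residual quadratic form represents a square, `c₁ ε` otherwise
      (∀ (x : ((cmDatum L 3 H').Local v)) (z : Fin 3 → 𝓀[(w.1.adicCompletion L)]), (x ∈ cmLocalIntegralLevel L 3 H' v ∧
        (∀ a b, Valued.v (ϖ⁻¹ * ((((x).val : GL (Fin 3) (UnitaryGroup.LocalRing L v)).val.map (Pi.evalRingHom (fun w' : PlacesOver L v => w'.1.adicCompletion L) w)) a b - (1 : Matrix (Fin 3) (Fin 3) (w.1.adicCompletion L)) a b)) ≤ 1) ∧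
        (redMat (ϖ⁻¹ • ((((x).val : GL (Fin 3) (UnitaryGroup.LocalRing L v)).val.map (Pi.evalRingHom (fun w' : PlacesOver L v => w'.1.adicCompletion L) w)) - 1))) ^ 3 = 0 ∧ (redMat (ϖ⁻¹ • ((((x).val : GL (Fin 3) (UnitaryGroup.LocalRing L v)).val.map (Pi.evalRingHom (fun w' : PlacesOver L v => w'.1.adicCompletion L) w)) - 1))).rank = 1 ∧
        z ⬝ᵥ ((redMat (placeForm H' w.1) * redMat (ϖ⁻¹ • ((((x).val : GL (Fin 3) (UnitaryGroup.LocalRing L v)).val.map (Pi.evalRingHom (fun w' : PlacesOver L v => w'.1.adicCompletion L) w)) - 1))) *ᵥ z) ≠ 0 ∧ IsSquare (z ⬝ᵥ ((redMat (placeForm H' w.1) * redMat (ϖ⁻¹ • ((((x).val : GL (Fin 3) (UnitaryGroup.LocalRing L v)).val.map (Pi.evalRingHom (fun w' : PlacesOver L v => w'.1.adicCompletion L) w)) - 1))) *ᵥ z))) →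
        g x = c₁ 1) ∧
      (∀ (x : ((cmDatum L 3 H').Local v)) (z : Fin 3 → 𝓀[(w.1.adicCompletion L)]), (x ∈ cmLocalIntegralLevel L 3 H' v ∧
        (∀ a b, Valued.v (ϖ⁻¹ * ((((x).val : GL (Fin 3) (UnitaryGroup.LocalRing L v)).val.map (Pi.evalRingHom (fun w' : PlacesOver L v => w'.1.adicCompletion L) w)) a b - (1 : Matrix (Fin 3) (Fin 3) (w.1.adicCompletion L)) a b)) ≤ 1) ∧
        (redMat (ϖ⁻¹ • ((((x).val : GL (Fin 3) (UnitaryGroup.LocalRing L v)).val.map (Pi.evalRingHom (fun w' : PlacesOver L v => w'.1.adicCompletion L) w)) - 1))) ^ 3 = 0 ∧ (redMat (ϖ⁻¹ • ((((x).val : GL (Fin 3) (UnitaryGroup.LocalRing L v)).val.map (Pi.evalRingHom (fun w' : PlacesOver L v => w'.1.adicCompletion L) w)) - 1))).rank = 1 ∧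
        z ⬝ᵥ ((redMat (placeForm H' w.1) * redMat (ϖ⁻¹ • ((((x).val : GL (Fin 3) (UnitaryGroup.LocalRing L v)).val.map (Pi.evalRingHom (fun w' : PlacesOver L v => w'.1.adicCompletion L) w)) - 1))) *ᵥ z) ≠ 0 ∧ ¬ IsSquare (z ⬝ᵥ ((redMat (placeForm H' w.1) * redMat (ϖ⁻¹ • ((((x).val : GL (Fin 3) (UnitaryGroup.LocalRing L v)).val.map (Pi.evalRingHom (fun w' : PlacesOver L v => w'.1.adicCompletion L) w)) - 1))) *ᵥ z))) →
        g x = c₁ ε) := by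
  classical
  letI : Fintype 𝓀[(w.1.adicCompletion L)] := Fintype.ofFinite _
  obtain ⟨c, c', c₁, hc0, hR1, hR2, hR3, hR4, hR5⟩ := exists_twoLayerStrataValues_of_levelOne_ramified L H' hH' w hw he hH'w hH'i h2 ϖ hϖ hσϖ A hA hframe g hginv hg1
  refine ⟨c, c', c₁, hc0, hR1, hR2, hR3, ?_, ?_⟩
  · rintro x z ⟨hxK, hint, hnil, hr, hz, hsq⟩
    rw [hR4 x z ⟨hxK, hint, hnil, hr, hz⟩]
    exact (apply_eq_apply_one_or_apply_eq_apply_nonsquare_of_sq_mul hε c₁ hR5 hz).1 hsq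
  · rintro x z ⟨hxK, hint, hnil, hr, hz, hns⟩
    rw [hR4 x z ⟨hxK, hint, hnil, hr, hz⟩]
    exact (apply_eq_apply_one_or_apply_eq_apply_nonsquare_of_sq_mul hε c₁ hR5 hz).2 hns

end Literature.NumberTheory.Rogawski1990

end
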